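import Mathlib
import Summits.Ventures.HodgeRepro2.T5EquivariantDescent

/-!
# T5CochainHom — equivariant `V^*`-valued functions on `Γ\G` = intertwining maps `V → C(Γ\G)`

Blind cell `pub-hodge-repro2`, Tier-5 support for sub-step N1 (route/T5-ID-p2.md, Theorem ID(iii)–(iv)).
Borel–Wallach's relative Lie algebra cochains are `C^q(𝔤, K; W) = Hom_K(∧^q 𝔭, W)` with
`W = C^∞(Γ\G)` under right translation; N1 uses them in the equivalent shape «a `K`-equivariant
function `F : Γ\G → (∧^q 𝔭)^*`» (ID-4(a)) and speaks of «a `K`-fixed vector of `K_1`-type `𝔭⁺`,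
the contragredient of the coefficient type `(𝔭⁺)^*` of the cochain» (ID-3(c)). This file proves the
dictionary between the two shapes, for any group `K ≤ G`, lattice `Γ ≤ G`, and any finite- or
infinite-dimensional coefficient representation `ρ : Representation R K V`:

* `rTrans Γ K : Representation R K (Γ\G → R)` — right translation `(k • φ) x = φ (x · k)`;
* `toHom F : V →ₗ[R] (Γ\G → R)`, `(toHom F) v x = F x v`, and its inverse `ofHom`;
* `isIntertwining_toHom_iff` — `F` is right-equivariant for `ρ.dual` (`F (x · k) = F x ∘ ρ k`)
  iff `toHom F` intertwines `ρ` with `rTrans` (`toHom F (ρ k v) = k • toHom F v`);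
* `cochainEquiv` — the linear equivalence `rightEquivariantQuot Γ K ρ.dual ≃ₗ[R]
  {Φ : V →ₗ[R] (Γ\G → R) // ρ.IsIntertwiningMap (rTrans Γ K) Φ}` = «`Hom_K(V, C(Γ\G))`»;
* the image of a vector: `toHom F v` is the scalar function `x ↦ F x v`, and for a `K`-eigenvector
  `v` of `ρ` (`ρ k v = χ k • v`) it is a `K`-eigenfunction of type `χ` under right translation
  (`toHom_rmul_of_eigen`) — «a `K`-fixed vector of `K_1`-type `𝔭⁺` gives a scalar automorphic
  function of the corresponding `K_1`-type».

What stays prose: smoothness / the `(𝔤, K)`-module structure (the `𝔤`-action on `C^∞(Γ\G)`), i.e.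
the differential of Borel–Wallach's complex; this file is the `K`-equivariance bookkeeping only.
-/

namespace Summit.Ventures.HodgeRepro2.T5CochainHom

open Summit.Ventures.HodgeRepro2.T5EquivariantDescent

variable {G : Type*} [Group G] (Γ K : Subgroup G)
variable {R : Type*} [CommSemiring R] {V : Type*} [AddCommMonoid V] [Module R V]

section RightTranslation

/-- Right translation of scalar functions on `Γ\G` by `K`: `(k • φ) x = φ (x · k)` — a
representation of `K` on `Γ\G → R` (the `K`-action on `C(Γ\G)` of Borel–Wallach's cochains). -/
def rTrans : Representation R K (RightQuot Γ → R) where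
  toFun k :=
    { toFun := fun φ x => φ (rmul Γ x k)
      map_add' := fun _ _ => rfl
      map_smul' := fun _ _ => rfl }
  map_one' := by
    ext φ x
    simp only [Subgroup.coe_one, rmul_one, LinearMap.coe_mk, AddHom.coe_mk, Module.End.one_apply]
  map_mul' g h := by
    ext φ x
    simp only [Subgroup.coe_mul, LinearMap.coe_mk, AddHom.coe_mk, Module.End.mul_apply, rmul_mul]

/-- Evaluation of `rTrans`. -/
@[simp] theorem rTrans_apply (k : K) (φ : RightQuot Γ → R) (x : RightQuot Γ) :
    rTrans Γ K k φ x = φ (rmul Γ x k) := rfl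

end RightTranslation

section Dictionary

variable {Γ K}

/-- From a `V^*`-valued function `F` on `Γ\G` to the linear map `V → (Γ\G → R)`, `v ↦ (x ↦ F x v)`
(the «cochain ↦ `K`-homomorphism» direction). -/
def toHom (F : RightQuot Γ → Module.Dual R V) : V →ₗ[R] (RightQuot Γ → R) where
  toFun v x := F x v
  map_add' v w := by funext x; simp only [map_add]; rfl
  map_smul' c v := by funext x; simp only [map_smul, RingHom.id_apply]; rfl

/-- Evaluation of `toHom`. -/
@[simp] theorem toHom_apply (F : RightQuot Γ → Module.Dual R V) (v : V) (x : RightQuot Γ) :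
    toHom F v x = F x v := rfl

/-- From a linear map `Φ : V → (Γ\G → R)` to the `V^*`-valued function `x ↦ (v ↦ Φ v x)`. -/
def ofHom (Φ : V →ₗ[R] (RightQuot Γ → R)) : RightQuot Γ → Module.Dual R V :=
  fun x =>
    { toFun := fun v => Φ v x
      map_add' := fun v w => by simp only [map_add]; rfl
      map_smul' := fun c v => by simp only [map_smul, RingHom.id_apply]; rfl }

/-- Evaluation of `ofHom`. -/
@[simp] theorem ofHom_apply (Φ : V →ₗ[R] (RightQuot Γ → R)) (x : RightQuot Γ) (v : V) :
    ofHom Φ x v = Φ v x := rfl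

/-- `ofHom` inverts `toHom`. -/
theorem ofHom_toHom (F : RightQuot Γ → Module.Dual R V) : ofHom (toHom F) = F := by
  funext x; ext v; rfl

/-- `toHom` inverts `ofHom`. -/
theorem toHom_ofHom (Φ : V →ₗ[R] (RightQuot Γ → R)) : toHom (ofHom Φ) = Φ := by
  ext v x; rfl

/-- Right-equivariance of `F` for the dual representation, unfolded: `F (x · k) = F x ∘ ρ k`. -/
theorem isRightEquivariantQuot_dual_iff (ρ : Representation R K V)
    (F : RightQuot Γ → Module.Dual R V) :
    IsRightEquivariantQuot Γ K ρ.dual F ↔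
      ∀ (x : RightQuot Γ) (k : K) (v : V), F (rmul Γ x k) v = F x (ρ k v) := by
  constructor
  · intro h x k v
    rw [h x k, Representation.dual_apply, Module.Dual.transpose_apply, LinearMap.comp_apply,
      inv_inv]
  · intro h x k
    ext v
    rw [h x k v, Representation.dual_apply, Module.Dual.transpose_apply, LinearMap.comp_apply,
      inv_inv]

/-- **The dictionary**: `F` is right-`K`-equivariant for `ρ.dual` iff `toHom F` is an intertwining
map from `ρ` to right translation `rTrans` — `(toHom F) (ρ k v) = k • (toHom F) v`. -/
theorem isIntertwining_toHom_iff (ρ : Representation R K V) (F : RightQuot Γ → Module.Dual R V) :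
    ρ.IsIntertwiningMap (rTrans Γ K) (toHom F) ↔ IsRightEquivariantQuot Γ K ρ.dual F := by
  rw [isRightEquivariantQuot_dual_iff, Representation.isIntertwiningMap_iff]
  constructor
  · intro h x k v
    have := congrFun (h k v) x
    simpa using this.symm
  · intro h k v
    funext x
    simpa using (h x k v).symm

/-- The same for `ofHom`. -/
theorem isRightEquivariantQuot_ofHom_iff (ρ : Representation R K V)
    (Φ : V →ₗ[R] (RightQuot Γ → R)) :
    IsRightEquivariantQuot Γ K ρ.dual (ofHom Φ) ↔ ρ.IsIntertwiningMap (rTrans Γ K) Φ := by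
  rw [← isIntertwining_toHom_iff, toHom_ofHom]

/-- The intertwining maps `V → (Γ\G → R)` as a submodule of the linear maps
(«`Hom_K(V, C(Γ\G))`»). -/
def homK (ρ : Representation R K V) : Submodule R (V →ₗ[R] (RightQuot Γ → R)) where
  carrier := {Φ | ρ.IsIntertwiningMap (rTrans Γ K) Φ}
  add_mem' := by
    intro Φ Ψ hΦ hΨ
    rw [Set.mem_setOf_eq, Representation.isIntertwiningMap_iff] at *
    intro k v
    simp only [LinearMap.add_apply, hΦ k v, hΨ k v, map_add]
  zero_mem' := by
    rw [Set.mem_setOf_eq, Representation.isIntertwiningMap_iff]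
    intro k v
    simp
  smul_mem' := by
    intro c Φ hΦ
    rw [Set.mem_setOf_eq, Representation.isIntertwiningMap_iff] at *
    intro k v
    simp only [LinearMap.smul_apply, hΦ k v, map_smul]

/-- Membership in `homK`. -/
theorem mem_homK (ρ : Representation R K V) (Φ : V →ₗ[R] (RightQuot Γ → R)) :
    Φ ∈ homK (Γ := Γ) ρ ↔ ρ.IsIntertwiningMap (rTrans Γ K) Φ := Iff.rfl

/-- **Cochains as `K`-homomorphisms**: the right-`K`-equivariant `V^*`-valued functions on `Γ\G`
are linearly isomorphic to `Hom_K(V, C(Γ\G))` — Borel–Wallach's `C^q(𝔤, K; C^∞(Γ\G)) =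
Hom_K(∧^q 𝔭, C^∞(Γ\G))` in its «equivariant `(∧^q 𝔭)^*`-valued function» shape. -/
def cochainEquiv (ρ : Representation R K V) :
    rightEquivariantQuot Γ K ρ.dual ≃ₗ[R] homK (Γ := Γ) ρ where
  toFun F := ⟨toHom F.1, (isIntertwining_toHom_iff ρ F.1).2 F.2⟩
  invFun Φ := ⟨ofHom Φ.1, (isRightEquivariantQuot_ofHom_iff ρ Φ.1).2 Φ.2⟩
  left_inv F := by
    apply Subtype.ext
    exact ofHom_toHom F.1
  right_inv Φ := by
    apply Subtype.ext
    exact toHom_ofHom Φ.1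
  map_add' F F' := by
    apply Subtype.ext
    ext v x
    rfl
  map_smul' c F := by
    apply Subtype.ext
    ext v x
    rfl

/-- Evaluation of `cochainEquiv`. -/
@[simp] theorem cochainEquiv_apply_coe (ρ : Representation R K V)
    (F : rightEquivariantQuot Γ K ρ.dual) :
    ((cochainEquiv ρ F : homK (Γ := Γ) ρ) : V →ₗ[R] (RightQuot Γ → R)) = toHom F.1 := rfl

/-- Evaluation of the inverse of `cochainEquiv`. -/
@[simp] theorem cochainEquiv_symm_apply_coe (ρ : Representation R K V) (Φ : homK (Γ := Γ) ρ) :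
    (((cochainEquiv ρ).symm Φ : rightEquivariantQuot Γ K ρ.dual) :
      RightQuot Γ → Module.Dual R V) = ofHom Φ.1 := rfl

end Dictionary

section Eigenvectors

variable {Γ K}

/-- **The scalar function of a `K`-eigenvector**: if `F` is right-equivariant for `ρ.dual` and `v`
is a `K`-eigenvector of `ρ` with character `χ` (`ρ k v = χ k • v`), then the scalar function
`x ↦ F x v` transforms by `χ` under right translation: `F (x · k) v = χ k * F x v` — a `K`-fixed
vector of `K_1`-type `𝔭⁺` gives, through a cochain, a scalar function of `K_1`-type `χ`. -/
theorem toHom_rmul_of_eigen (ρ : Representation R K V) {F : RightQuot Γ → Module.Dual R V}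
    (hF : IsRightEquivariantQuot Γ K ρ.dual F) {v : V} {χ : K → R} (hv : ∀ k, ρ k v = χ k • v)
    (x : RightQuot Γ) (k : K) : toHom F v (rmul Γ x k) = χ k * toHom F v x := by
  rw [toHom_apply, toHom_apply, (isRightEquivariantQuot_dual_iff ρ F).1 hF x k v, hv k, map_smul,
    smul_eq_mul]

/-- For a `K`-invariant vector (`ρ k v = v`) the scalar function is right-`K`-invariant. -/
theorem toHom_rmul_of_invariant (ρ : Representation R K V) {F : RightQuot Γ → Module.Dual R V}
    (hF : IsRightEquivariantQuot Γ K ρ.dual F) {v : V} (hv : ∀ k, ρ k v = v) (x : RightQuot Γ)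
    (k : K) : toHom F v (rmul Γ x k) = toHom F v x := by
  rw [toHom_apply, toHom_apply, (isRightEquivariantQuot_dual_iff ρ F).1 hF x k v, hv k]

/-- Linearity of the dictionary in `F`: the scalar function of `v` is additive in `F`. -/
theorem toHom_add (F F' : RightQuot Γ → Module.Dual R V) : toHom (F + F') = toHom F + toHom F' := by
  ext v x; rfl

/-- Homogeneity of the dictionary in `F`. -/
theorem toHom_smul (c : R) (F : RightQuot Γ → Module.Dual R V) : toHom (c • F) = c • toHom F := by
  ext v x; rfl

end Eigenvectors

end Summit.Ventures.HodgeRepro2.T5CochainHom
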